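import Literature.NumberTheory.EllipticCurves.PeriodIndexSupportProofs
import HarnessLib

/-!
# X11b (team N8/O2), S15 (vi): the receptacle `E⁰(K̄_v) ≤ E(K̄_v)` — points with nonsingular
# reduction on the minimal model at `v`, as ONE named subgroup of the local coefficient module

HONEST FRAMING (cell `b2b-bsdres`, run/shared/lean/b2b/bsd-rank1-residual/, verbatim in every
file): the goal of the cell is to DELETE the COMBINATION-SHAPED residual classes of the
Birch–Swinnerton-Dyer formula for ALL analytic-rank `≤ 1` elliptic curves over `ℚ` — "full BSD
formula for every rank `≤ 1` curve in class `C`" assembled STRICTLY from published theorems — so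
that the rank-`≤ 1` remainder becomes exactly the CONSTRUCTION-SHAPED classes, which are TYPED
(missing-input `Prop`s), NOT attempted. This is not "finishing BSD". Team N8/O2 = `x11b3`, seat
`b2b-bsdres-x11b3-p2` (GEN 3), LEAD DEAL #7 R7-51 (S15 (vi), design (R-b): "ONE reviewed def
`E0Receptacle` = E⁰ via the minimal model, path not under `Three/`"). ONE DEFINITION + lemmas; no
named fact; no `sorry`; nothing is booked; no flag is discharged.

## What

x11b3-p8's unramified-class theorems (`UnramifiedNode.oneCocycleClass_eq_zero_of_has{Multiplicative,Additive}ReductionAt`,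
Milne *ADT* I.3.8 for `𝒜° = E⁰`) and the (iv) END FORM of Gross 1991 Prop. 6.2 (1)
(`GrossBadPlace.kolyvaginClass_kolyvaginPoint_mem_selmerLocalKer_of_GZ31_…`) speak of a receptacle
`B ≤ E(K̄_v) = localPoints W K_v` "consisting of points with nonsingular reduction on the minimal
model at `v`", said through THREE existential witnesses of the tree taken as parameters — the
spectral valuation `w` of `K̄_v` (`exists_spectralValuation`), the structure map `ι : 𝓞_v → 𝒪_w`
(`exists_ringHom_adicCompletionIntegers_integer`) and the change of variables `C` to the minimal
model (`exists_variableChange_eq_localMinimalIntegralModel`) — plus `B` and `hB : B ⊆ E⁰`: five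
binders per place. This file names the object once:

* `E0Receptacle W v : AddSubgroup (localPoints W (v.adicCompletion K))` — **`E⁰(K̄_v)`**: the
  pull-back, along the tree's transport `Φ : E(K̄_v) ≃ V(K̄_v)` to the minimal model
  `M = W.localMinimalIntegralModel v` read over the valuation ring `𝒪_w` of `K̄_v` (the witnesses
  being CHOSEN once and for all by `Classical.choose` from the three existence theorems), of the
  tree's subgroup `nonsingularReductionSubgroup` of points with nonsingular reduction (Silverman
  *AEC* VII.2.1: "`E₀` is a subgroup"). Printed object: the points of the identity component of the
  Néron model over `K̄_v` = the points reducing to the smooth locus of the minimal Weierstrass model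
  (Silverman *AEC* VII.2, VII.§5; [GZ86, III (3.1)]'s `E⁰`).
* `mem_E0Receptacle_iff` — membership unfolded: `Q ∈ E0Receptacle W v ↔ (M.map ι₀).HasNonsingularReduction (Φ₀ Q)`
  with the chosen witnesses `w₀`, `ι₀`, `C₀` — i.e. EXACTLY the binder `hB` of x11b3-p8's theorems
  for `B = E0Receptacle W v` (so their consumers lose the binders `w hw ι hι C hC B hB`);
  `E0Receptacle_spec_w`, `E0Receptacle_spec_ι`, `E0Receptacle_spec_C` — the defining properties of
  the chosen witnesses (for feeding theorems that take them as hypotheses).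

NOT here: the consumers (`X11b/Three/KolyvaginClassBadPlaceEndS15`, `KolyvaginLeafAGZ31`) and any
claim that a given point LIES in `E⁰` ([GZ86, III (3.1)] stays a cite-only binder of theirs).

References (locators only; no new fact): [cite: SilvermanAEC2009, VII.2 Prop. 2.1 (PDF p. 167),
VII.§5] [cite: GrossZagier1986, III (3.1)] [cite: MilneADT2006, Ch. I Prop. 3.8]
[cite: NeukirchANT1999, Ch. II Thm. (4.8)]; tree files `ReductionHomomorphism`
(`nonsingularReductionSubgroup`), `SelmerFiniteProofs` (`exists_spectralValuation`,
`baseChange_baseChange_adicCompletion`), `GoodReductionLangLift`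
(`exists_ringHom_adicCompletionIntegers_integer`), `HasseWeilGoodReductionFrobeniusProofs`
(`exists_variableChange_eq_localMinimalIntegralModel`), `VariableChangePointsMap`.

## Design

ONE `def` (review-queued), the witnesses chosen inside it by `Classical.choose` (no auxiliary
definitions); `noncomputable section`; `open scoped Classical NNReal`. Namespace
`Summit.BirchSwinnertonDyer.Rank1Residual.X11b`. Axioms: `propext`, `Classical.choice`,
`Quot.sound`.
-/

noncomputable section

open scoped Classical NNReal
open NumberField IsDedekindDomain

namespace Summit.BirchSwinnertonDyer.Rank1Residual.X11b

open WeierstrassCurve Literature.NumberTheory.EllipticCurves IsDedekindDomain.HeightOneSpectrum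

universe u

variable {K : Type u} [Field K] [NumberField K] (W : WeierstrassCurve K)
  (v : HeightOneSpectrum (𝓞 K))

/-- The `𝒪_w`-model equation: along the chosen structure map `ι₀ : 𝓞_v → 𝒪_{w₀}` an `𝓞_v`-equation
`M` read in `K̄_v` through `K_v` is the `𝒪_{w₀}`-equation `M.map ι₀` read in `K̄_v`
(`(M ⊗ K_v) ⊗ K̄_v = (M.map ι₀) ⊗ K̄_v`; x11b3-p8's `baseChange_map_eq_baseChange_map`, here for the
chosen witnesses). [folklore] -/
theorem baseChange_map_eq_baseChange_map_choose (M : WeierstrassCurve (v.adicCompletionIntegers K)) :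
    (M.map (algebraMap (v.adicCompletionIntegers K) (v.adicCompletion K))).baseChange
        (AlgebraicClosure (v.adicCompletion K)) =
      (M.map (exists_ringHom_adicCompletionIntegers_integer
        (v.exists_spectralValuation).choose_spec).choose).baseChange
        (AlgebraicClosure (v.adicCompletion K)) := by
  have hι := (exists_ringHom_adicCompletionIntegers_integer
    (v.exists_spectralValuation).choose_spec).choose_spec
  have hcompL : (algebraMap ((v.exists_spectralValuation).choose.integer)
      (AlgebraicClosure (v.adicCompletion K))).comp
        (exists_ringHom_adicCompletionIntegers_integer
          (v.exists_spectralValuation).choose_spec).choose =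
      (algebraMap (v.adicCompletion K) (AlgebraicClosure (v.adicCompletion K))).comp
        (algebraMap (v.adicCompletionIntegers K) (v.adicCompletion K)) := by
    ext a
    exact hι a
  simp only [baseChange, WeierstrassCurve.map_map, hcompL]

/-- **`E⁰(K̄_v) ≤ E(K̄_v)`: the receptacle of points with nonsingular reduction on the minimal model
at `v`.** For `W/K` over a number field and a finite place `v`, with the CHOSEN witnesses
`w₀` (the spectral valuation of `K̄_v`, `exists_spectralValuation`), `ι₀ : 𝓞_v → 𝒪_{w₀}`
(`exists_ringHom_adicCompletionIntegers_integer`) and `C₀` (`C₀ • W_{K_v} = M ⊗ K_v`,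
`M = W.localMinimalIntegralModel v`, `exists_variableChange_eq_localMinimalIntegralModel`): the
pull-back along the transport `Φ₀ : localPoints W K_v = W_{K̄_v}(K̄_v) ≃ (M.map ι₀ ⊗ K̄_v)(K̄_v)`
(`congrEquiv` ∘ `pointEquivBaseChange C₀` ∘ `congrEquiv`, as in the tree's
`Milne2006_unramifiedClass_eq_zero_holds`) of the subgroup of points with nonsingular reduction
`(M.map ι₀).nonsingularReductionSubgroup` (Silverman *AEC* VII.2.1). Printed object: `E⁰(K̄_v)`,
the points of the identity component of the Néron model = the points reducing into the smooth
locus of the minimal Weierstrass model ([GZ86, III (3.1)]'s `E⁰`; Silverman *AEC* VII.2, VII.§5).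
[cite: SilvermanAEC2009, VII.2 Prop. 2.1 (PDF p. 167)] -/
def E0Receptacle : AddSubgroup (localPoints W (v.adicCompletion K)) :=
  (((W.localMinimalIntegralModel v).map
        (exists_ringHom_adicCompletionIntegers_integer
          (v.exists_spectralValuation).choose_spec).choose).nonsingularReductionSubgroup
      (Valuation.integer.integers (v.exists_spectralValuation).choose)).comap
    (AddEquiv.toAddMonoidHom <|
      (Affine.Point.congrEquiv (baseChange_baseChange_adicCompletion W v).symm).trans <|
        (VariableChange.pointEquivBaseChange (W.baseChange (v.adicCompletion K))
            (W.exists_variableChange_eq_localMinimalIntegralModel v).choose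
            (AlgebraicClosure (v.adicCompletion K))).trans <|
          (Affine.Point.congrEquiv (congrArg (fun X : WeierstrassCurve (v.adicCompletion K) ↦
              X.baseChange (AlgebraicClosure (v.adicCompletion K)))
              (W.exists_variableChange_eq_localMinimalIntegralModel v).choose_spec)).trans
            (Affine.Point.congrEquiv
              (baseChange_map_eq_baseChange_map_choose v (W.localMinimalIntegralModel v))))

/-- **Membership in `E⁰(K̄_v)`, unfolded** — exactly the binder `hB` of x11b3-p8's
`UnramifiedNode.oneCocycleClass_eq_zero_of_has{Multiplicative,Additive}ReductionAt` and of the (iv)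
END FORM for `B = E0Receptacle W v` and the chosen witnesses: `Q ∈ E⁰(K̄_v)` iff the transported
point has nonsingular reduction on `M.map ι₀`. [cite: SilvermanAEC2009, VII.2 Prop. 2.1] -/
theorem mem_E0Receptacle_iff (Q : localPoints W (v.adicCompletion K)) :
    Q ∈ E0Receptacle W v ↔
      ((W.localMinimalIntegralModel v).map
        (exists_ringHom_adicCompletionIntegers_integer
          (v.exists_spectralValuation).choose_spec).choose).HasNonsingularReduction
        (Affine.Point.congrEquiv
          (baseChange_map_eq_baseChange_map_choose v (W.localMinimalIntegralModel v))
          (Affine.Point.congrEquiv (congrArg (fun X : WeierstrassCurve (v.adicCompletion K) ↦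
              X.baseChange (AlgebraicClosure (v.adicCompletion K)))
              (W.exists_variableChange_eq_localMinimalIntegralModel v).choose_spec)
            (VariableChange.pointEquivBaseChange (W.baseChange (v.adicCompletion K))
              (W.exists_variableChange_eq_localMinimalIntegralModel v).choose
              (AlgebraicClosure (v.adicCompletion K))
              (Affine.Point.congrEquiv (baseChange_baseChange_adicCompletion W v).symm Q)))) := by
  rw [E0Receptacle, AddSubgroup.mem_comap, mem_nonsingularReductionSubgroup_iff]
  rfl

/-- `O ∈ E⁰(K̄_v)`. [folklore] -/
theorem zero_mem_E0Receptacle : (0 : localPoints W (v.adicCompletion K)) ∈ E0Receptacle W v :=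
  (E0Receptacle W v).zero_mem

end Summit.BirchSwinnertonDyer.Rank1Residual.X11b

end
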